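import Summits.QuantumAdvantage.QuantumAdvantage.Theorems.NearExactIsExact.Negative.QuarterSlicingFourteen
import Summits.QuantumAdvantage.QuantumAdvantage.Theorems.CubicForrelationNearExactIsExactRothausB
import Summits.QuantumAdvantage.QuantumAdvantage.Theorems.NearExactIsExact.Negative.DigitThreeDegreeTwelve
import HarnessLib

/-!
# Case A is dead in the n = 14 window (THEOREM CA-W, normal form) — NearExactIsExact, disprover gen 23

Negative/structural lemma for the crux `CubicForrelation.NearExactIsExact` (item r2), finite slice `n = 14`.
HONEST FRAMING: the value here is a THEOREM about cubic Boolean functions on 14 bits — it closes one residual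
case ("case A", alias the `(β,β)` residue) of the open window `(15/16, 31/32)` at `n = 14` left by
`fo_second_structure_sharp` — NOT summit progress; no violation of `NearExactIsExact`, no new per-`n` value.

Setting (tree, `…FourteenLevelSixPrep`, `…FourteenDigits`): for a cubic `g` on `14` bits `W_g = 32u`; `g` is
TYPE O iff every `u(x)` is odd; then the first digit `d₁ = [⌊u/2⌋ odd]` is quadratic (`fd_digitOne`) and
CASE A means `[⌊u/2⌋ odd] ≠ [⌊u/4⌋ odd]` everywhere, i.e. `u mod 8 ∈ {3, 5}` — the all-cheap residue pattern for
a partner at `Φ = 31/32`.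

Main result `caseA_window_false` (normal form of the digit quadratic: `d₁(p,q,a) = pq ⊕ λ(a)` on the dual
coordinates `0, 1`; by `no_caseA_rank_zero`/shift covariance and a one-sided 4-coordinate slice the rank of
`d₁` is exactly `2` in case A, and `GL(14,2)`-covariance of `Φ` puts `d₁` in this form — those reductions are
NOT part of this file): if `f, g` are cubic, `g` is type O and case A in normal form, then `Φ(f,g) ≤ 59/64`.

Mechanism (quarter slicing, new for this lane): with `g_{pq}(y) = g(p,q,y)` the four 12-bit quarters,
`W_g(a₀,a₁,a) = Σ_{p,q} (−1)^{a₀p + a₁q} W_{g_{pq}}(a)` (`qs_W_split2`, file `Negative/QuarterSlicingFourteen`), so `W_{g₀₀} = 16w` with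
`2w = Σ_{p,q} u(p,q,·)`; the case-A residues make `g₀₀` TYPE O on 12 bits with second digit `λ` and third digit
`κ ⊕ τ ⊕ λ`, where `τ` is the fibre parity of `f` (affine: Ax on the cubes `{0,1} ∪ (I+2)`, `stub_axParity`) and
`κ` the fibre parity of the defect `k = (u − 4(−1)^f − χ)/8`.  The budget `Σ (u − 4(−1)^f)² = 2¹⁹(1 − Φ)`
(`fl_budget5`) gives `#supp k ≤ 511 < 512 = d_min RM(3,12)` when `Φ > 59/64`, so the cubic `κ`
(`digit_three` + `fc_deg_bxor`) vanishes (`bb_rmWeight_holds`) and the third digit of `g₀₀` is affine —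
contradicting `digit_three_not_affine` (D3NA, `Negative/DigitThreeDegreeTwelve`).

Sources: Ax / McEliece divisibility and Reed–Muller minimum weights [cite Carlet2020 §4.1]; everything else
[this work] / [folklore]. Standard axioms only; no `decide` on large types.
-/

set_option linter.dupNamespace false -- D-0017: single-problem summit ⇒ `QuantumAdvantage.QuantumAdvantage` by design

noncomputable section

namespace Summit.QuantumAdvantage.QuantumAdvantage.Theorems.NearExactIsExact.Negative.CaseAWindowFourteen

open Finset
open Literature.Computability.QuantumComplexity
open Literature.Computability.QuantumComplexity.DerivativeWalsh (W)
open Summit.QuantumAdvantage.QuantumAdvantage.Theorems.CubicForrelation.NearExactIsExact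
open Summit.QuantumAdvantage.QuantumAdvantage.Theorems.NearExactIsExact.Negative.TypeOTwelve
  (digit_two digit_three digit_three_not_affine)
open Summit.QuantumAdvantage.QuantumAdvantage.Theorems.NearExactIsExact.Negative.QuarterSlicingFourteen

set_option maxHeartbeats 800000 in
/-- **THEOREM CA-W (normal form).** Let `f, g` be cubic on `14` bits, `W_g = 32u` with every `u(x)` odd (type O) and
CASE A (`[⌊u/2⌋ odd] ≠ [⌊u/4⌋ odd]` everywhere), and suppose the digit quadratic is in normal form
`[⌊u(p,q,a)/2⌋ odd] = pq ⊕ λ(a)` (rank `2` on coordinates `0,1`; `λ` arbitrary). Then `Φ(f,g) ≤ 59/64`.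
Proof: quarter slicing over coordinates `0,1` (`qs_W_split2`) makes `g₀₀` a type-O cubic on `12` bits with `W = 16w`,
`2w = Σ_{p,q} u(p,q,·)`, second digit `λ` and third digit `κ ⊕ τ ⊕ λ`, where `τ` = fibre parity of `f` (affine, by Ax on
the cubes `{0,1} ∪ (I+2)`) and `κ` = fibre parity of `k = (u − 4(−1)^f − χ)/8`; the budget `Σ (u − 4(−1)^f)² = 2¹⁹(1−Φ)`
(`fl_budget5`) and `Φ > 59/64` give `#supp k ≤ 511 < 512`, so the cubic `κ` vanishes (`bb_rmWeight_holds`) and the third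
digit `τ ⊕ λ` is affine — contradicting `digit_three_not_affine` (D3NA, n = 12). NOT summit progress. [this work] -/
theorem caseA_window_false (f g : (Fin (7 + 7) → Bool) → Bool) (hf : IsDegLeFun 3 f) (hg : IsDegLeFun 3 g)
    (u : (Fin (7 + 7) → Bool) → ℤ) (hu : ∀ x, W (fun y => signOf (g y)) x = (2 : ℝ) ^ 5 * (u x : ℝ))
    (hodd : ∀ x, Odd (u x)) (hA : ∀ x, ¬ (Odd (u x / 2) ↔ Odd (u x / 2 / 2)))
    (lam : (Fin (6 + 6) → Bool) → Bool)
    (hd1 : ∀ (p q : Bool) (a : Fin (6 + 6) → Bool),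
      Odd (u (Fin.cons p (Fin.cons q a : Fin (6 + 6 + 1) → Bool) : Fin (7 + 7) → Bool) / 2) ↔ ((p && q) ^^ lam a) = true)
    (hΦ : (59 / 64 : ℝ) < forrelation f g) : False := by
  classical
  -- χ = (−1)^{d₁} and the defect k = (u − 4(−1)^f − χ)/8
  set χ : (Fin (7 + 7) → Bool) → ℤ := fun x => if Odd (u x / 2) then -1 else 1 with hχ
  set k : (Fin (7 + 7) → Bool) → ℤ := fun x => (u x - 4 * sZ (f x) - χ x) / 8 with hkdef
  have hk : ∀ x, u x - 4 * sZ (f x) = χ x + 8 * k x := by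
    intro x
    have hr := qs_residue (u x) (hodd x) (hA x)
    rcases tp_sZ_cases (f x) with hs | hs
    · simp only [hkdef, hχ, hs]
      by_cases ho : Odd (u x / 2)
      · rw [if_pos ho]; have h3 := hr.1 ho; omega
      · rw [if_neg ho]; have h5 := hr.2 ho; omega
    · simp only [hkdef, hχ, hs]
      by_cases ho : Odd (u x / 2)
      · rw [if_pos ho]; have h3 := hr.1 ho; omega
      · rw [if_neg ho]; have h5 := hr.2 ho; omega
  have hχ1 : ∀ x, χ x = 1 ∨ χ x = -1 := fun x => by
    simp only [hχ]; split_ifs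
    · exact Or.inr rfl
    · exact Or.inl rfl
  -- the budget: Σ (4k² + χk) < 1536
  have hB := fl_budget5 f g u hu
  have hlt : (∑ x, (u x - 4 * sZ (f x)) ^ 2 : ℤ) < 40960 := by
    have h' : ((∑ x, (u x - 4 * sZ (f x)) ^ 2 : ℤ) : ℝ) < 40960 := by
      rw [hB]; have := hΦ; norm_num at this ⊢; linarith
    exact_mod_cast h'
  have hptw : ∀ x, (u x - 4 * sZ (f x)) ^ 2 = 1 + 16 * (4 * k x ^ 2 + χ x * k x) := by
    intro x; rw [hk x]; rcases hχ1 x with h | h <;> rw [h] <;> ring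
  have hexp : (∑ x, (u x - 4 * sZ (f x)) ^ 2 : ℤ) = 2 ^ 14 + 16 * ∑ x, (4 * k x ^ 2 + χ x * k x) := by
    rw [sum_congr rfl fun x _ => hptw x, sum_add_distrib, ← mul_sum, sum_const, card_univ, Fintype.card_fun,
      Fintype.card_bool, Fintype.card_fin, nsmul_eq_mul]
    norm_num
  have hbud : ∑ x, (4 * k x ^ 2 + χ x * k x) < 1536 := by omega
  -- support of k: at most 511 points
  have hterm : ∀ x, 3 * (if k x ≠ 0 then (1 : ℤ) else 0) ≤ 4 * k x ^ 2 + χ x * k x := by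
    intro x
    by_cases h0 : k x = 0
    · simp [h0]
    · rw [if_pos h0]
      rcases lt_or_gt_of_ne h0 with hn | hp
      · have hn' : k x ≤ -1 := by omega
        rcases hχ1 x with h | h <;> rw [h] <;> nlinarith
      · have hp' : 1 ≤ k x := by omega
        rcases hχ1 x with h | h <;> rw [h] <;> nlinarith
  have hcardk : (∑ x, (if k x ≠ 0 then (1 : ℤ) else 0)) = #{x : Fin (7 + 7) → Bool | k x ≠ 0} := by
    rw [Finset.sum_boole]
  have hsupp : (#{x : Fin (7 + 7) → Bool | k x ≠ 0} : ℤ) ≤ 511 := by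
    have h3 := sum_le_sum fun x (_ : x ∈ (univ : Finset (Fin (7 + 7) → Bool))) => hterm x
    rw [← mul_sum, hcardk] at h3
    omega
  -- residues of the four points of a fibre, and S = Σ_{p,q} u(p,q,·)
  have hres : ∀ (p q : Bool) (a : Fin (6 + 6) → Bool),
      (((p && q) ^^ lam a) = true → u (Fin.cons p (Fin.cons q a : Fin (6 + 6 + 1) → Bool) : Fin (7 + 7) → Bool) % 8 = 3) ∧
        (((p && q) ^^ lam a) = false → u (Fin.cons p (Fin.cons q a : Fin (6 + 6 + 1) → Bool) : Fin (7 + 7) → Bool) % 8 = 5) := by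
    intro p q a
    have hr := qs_residue (u (Fin.cons p (Fin.cons q a : Fin (6 + 6 + 1) → Bool) : Fin (7 + 7) → Bool)) (hodd _) (hA _)
    have hd := hd1 p q a
    refine ⟨fun h => hr.1 (hd.2 h), fun h => hr.2 fun ho => ?_⟩
    rw [hd.1 ho] at h
    exact Bool.noConfusion h
  set S : (Fin (6 + 6) → Bool) → ℤ := fun a =>
    u (Fin.cons false (Fin.cons false a : Fin (6 + 6 + 1) → Bool) : Fin (7 + 7) → Bool) +
      u (Fin.cons false (Fin.cons true a : Fin (6 + 6 + 1) → Bool) : Fin (7 + 7) → Bool) +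
      u (Fin.cons true (Fin.cons false a : Fin (6 + 6 + 1) → Bool) : Fin (7 + 7) → Bool) +
      u (Fin.cons true (Fin.cons true a : Fin (6 + 6 + 1) → Bool) : Fin (7 + 7) → Bool) with hSdef
  have hS8f : ∀ a, lam a = false → S a % 8 = 2 := by
    intro a hl
    have e1 := (hres false false a).2 (by rw [hl]; rfl)
    have e2 := (hres false true a).2 (by rw [hl]; rfl)
    have e3 := (hres true false a).2 (by rw [hl]; rfl)
    have e4 := (hres true true a).1 (by rw [hl]; rfl)
    simp only [hSdef]; omega
  have hS8t : ∀ a, lam a = true → S a % 8 = 6 := by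
    intro a hl
    have e1 := (hres false false a).1 (by rw [hl]; rfl)
    have e2 := (hres false true a).1 (by rw [hl]; rfl)
    have e3 := (hres true false a).1 (by rw [hl]; rfl)
    have e4 := (hres true true a).2 (by rw [hl]; rfl)
    simp only [hSdef]; omega
  -- w = S/2 = W_{g₀₀}/16
  set w : (Fin (6 + 6) → Bool) → ℤ := fun a => S a / 2 with hwdef
  have hSw : ∀ a, S a = 2 * w a := by
    intro a; simp only [hwdef]; cases hl : lam a
    · have := hS8f a hl; omega
    · have := hS8t a hl; omega
  have hw4 : ∀ a, (lam a = false → w a % 4 = 1) ∧ (lam a = true → w a % 4 = 3) := by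
    intro a; simp only [hwdef]
    exact ⟨fun hl => by have := hS8f a hl; omega, fun hl => by have := hS8t a hl; omega⟩
  set g₀ : (Fin (6 + 6) → Bool) → Bool :=
    fun y => g (Fin.cons false (Fin.cons false y : Fin (6 + 6 + 1) → Bool) : Fin (7 + 7) → Bool) with hg₀def
  have hg₀ : IsDegLeFun 3 g₀ := qs_quarter_isDegLeFun g hg false false
  have s0 : signOf false = 1 := by simp [signOf]
  have s1 : signOf true = -1 := by simp [signOf]
  have hW₀ : ∀ a, W (fun y => signOf (g₀ y)) a = (2 : ℝ) ^ 4 * (w a : ℝ) := by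
    intro a
    have e1 := qs_W_split2 g false false a
    have e2 := qs_W_split2 g false true a
    have e3 := qs_W_split2 g true false a
    have e4 := qs_W_split2 g true true a
    rw [hu] at e1 e2 e3 e4
    simp only [s0, s1] at e1 e2 e3 e4
    have hsum : (2 : ℝ) ^ 5 * ((S a : ℤ) : ℝ) =
        4 * W (fun y => signOf (g (Fin.cons false (Fin.cons false y : Fin (6 + 6 + 1) → Bool) : Fin (7 + 7) → Bool))) a := by
      simp only [hSdef]; push_cast; linarith
    rw [hSw a] at hsum
    push_cast at hsum
    rw [hg₀def]
    beta_reduce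
    linarith
  -- digits of w: u₁ = ⌊w/2⌋ has parity λ, t = [u₁ odd], u₂ = ⌊u₁/2⌋
  set u₁ : (Fin (6 + 6) → Bool) → ℤ := fun a => w a / 2 with hu₁def
  set t : (Fin (6 + 6) → Bool) → ℤ := fun a => if Odd (u₁ a) then 1 else 0 with htdef
  set u₂ : (Fin (6 + 6) → Bool) → ℤ := fun a => u₁ a / 2 with hu₂def
  have h1 : ∀ a, w a = 2 * u₁ a + 1 := by
    intro a; simp only [hu₁def]; cases hl : lam a
    · have := (hw4 a).1 hl; omega
    · have := (hw4 a).2 hl; omega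
  have h2 : ∀ a, u₁ a = 2 * u₂ a + t a := by
    intro a; simp only [hu₂def, htdef]
    by_cases ho : Odd (u₁ a)
    · rw [if_pos ho]; have := Int.odd_iff.1 ho; omega
    · rw [if_neg ho]; have := Int.even_iff.1 (Int.not_odd_iff_even.1 ho); omega
  have ht : ∀ a, t a = if Odd (u₁ a) then 1 else 0 := fun a => rfl
  have hu₁lam : ∀ a, decide (Odd (u₁ a)) = lam a := by
    intro a; simp only [hu₁def]; cases hl : lam a
    · have := (hw4 a).1 hl
      exact decide_eq_false (by rw [Int.not_odd_iff_even, Int.even_iff]; omega)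
    · have := (hw4 a).2 hl
      exact decide_eq_true (by rw [Int.odd_iff]; omega)
  have hlam : IsDegLeFun 1 lam := by
    have h := digit_two g₀ w hg₀ hW₀ u₁ h1
    rwa [show (fun a => decide (Odd (u₁ a))) = lam from funext hu₁lam] at h
  have hD3 : IsDegLeFun 3 (fun a => decide (Odd (u₂ a))) := digit_three g₀ w hg₀ hW₀ u₁ u₂ t h1 h2 ht
  -- fibre parities: τ (of f) and κ (of k)
  set Nf : (Fin (6 + 6) → Bool) → ℤ := fun a =>
    ∑ p : Bool, ∑ q : Bool,
      (if f (Fin.cons p (Fin.cons q a : Fin (6 + 6 + 1) → Bool) : Fin (7 + 7) → Bool) = true then (1 : ℤ) else 0) with hNfdef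
  set Kq : (Fin (6 + 6) → Bool) → ℤ := fun a => ∑ p : Bool, ∑ q : Bool,
    k (Fin.cons p (Fin.cons q a : Fin (6 + 6 + 1) → Bool) : Fin (7 + 7) → Bool) with hKqdef
  set τ : (Fin (6 + 6) → Bool) → Bool := fun a => decide (Odd (Nf a)) with hτdef
  set κ : (Fin (6 + 6) → Bool) → Bool := fun a => decide (Odd (Kq a)) with hκdef
  -- the digit identity [u₂ odd] = κ ⊕ τ ⊕ λ (a 2-adic computation on the four points of the fibre)
  have hc : ∀ (p q : Bool) (a : Fin (6 + 6) → Bool),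
      χ (Fin.cons p (Fin.cons q a : Fin (6 + 6 + 1) → Bool) : Fin (7 + 7) → Bool) = if ((p && q) ^^ lam a) = true then -1 else 1 := by
    intro p q a; simp only [hχ]; exact if_congr (hd1 p q a) rfl rfl
  have hsZ' : ∀ b : Bool, sZ b = 1 - 2 * (if b = true then (1 : ℤ) else 0) := by intro b; cases b <;> simp [sZ]
  have hn01 : ∀ b : Bool, (if b = true then (1 : ℤ) else 0) = 0 ∨ (if b = true then (1 : ℤ) else 0) = 1 := by
    intro b; cases b <;> simp
  have hchi : ∀ (p q : Bool) (a : Fin (6 + 6) → Bool),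
      χ (Fin.cons p (Fin.cons q a : Fin (6 + 6 + 1) → Bool) : Fin (7 + 7) → Bool) =
      if (p && q) = true then 2 * ((lam a).toNat : ℤ) - 1 else 1 - 2 * ((lam a).toNat : ℤ) := by
    intro p q a; rw [hc]; cases hpq : (p && q) <;> cases hl : lam a <;> simp
  have hDig : ∀ a, decide (Odd (u₂ a)) = ((κ a ^^ τ a) ^^ lam a) := by
    intro a
    simp only [hκdef, hτdef]
    apply qs_bool_of_par
    have k1 := hk (Fin.cons false (Fin.cons false a : Fin (6 + 6 + 1) → Bool) : Fin (7 + 7) → Bool)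
    have k2 := hk (Fin.cons false (Fin.cons true a : Fin (6 + 6 + 1) → Bool) : Fin (7 + 7) → Bool)
    have k3 := hk (Fin.cons true (Fin.cons false a : Fin (6 + 6 + 1) → Bool) : Fin (7 + 7) → Bool)
    have k4 := hk (Fin.cons true (Fin.cons true a : Fin (6 + 6 + 1) → Bool) : Fin (7 + 7) → Bool)
    rw [hsZ', hchi] at k1 k2 k3 k4
    simp only [Bool.false_and, Bool.true_and, Bool.false_eq_true, ite_false, ite_true] at k1 k2 k3 k4
    have n1 := hn01 (f (Fin.cons false (Fin.cons false a : Fin (6 + 6 + 1) → Bool) : Fin (7 + 7) → Bool))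
    have n2 := hn01 (f (Fin.cons false (Fin.cons true a : Fin (6 + 6 + 1) → Bool) : Fin (7 + 7) → Bool))
    have n3 := hn01 (f (Fin.cons true (Fin.cons false a : Fin (6 + 6 + 1) → Bool) : Fin (7 + 7) → Bool))
    have n4 := hn01 (f (Fin.cons true (Fin.cons true a : Fin (6 + 6 + 1) → Bool) : Fin (7 + 7) → Bool))
    have hlt : ((lam a).toNat : ℤ) = 0 ∨ ((lam a).toNat : ℤ) = 1 := by cases lam a <;> simp
    simp only [hu₂def, hu₁def, hwdef, hKqdef, hNfdef, Fintype.sum_bool, hSdef]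
    omega
  -- τ is affine: Ax on the cubes {0,1} ∪ (I+2) with |I| ≥ 2
  have hτ : IsDegLeFun 1 τ := by
    refine bb_moebius_isDegLeFun 1 τ fun I hI => ?_
    obtain ⟨z, hz⟩ := stub_axParity (7 + 7) 3 f
      (insert (0 : Fin (7 + 7)) (insert (1 : Fin (7 + 7))
        (Finset.image (fun j : Fin (6 + 6) => (Fin.succ (Fin.succ j) : Fin (7 + 7))) I))) (by norm_num) hf
    have hsign : ∀ x, signOf (f x) = 1 - 2 * ((if f x = true then (1 : ℤ) else 0 : ℤ) : ℝ) := by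
      intro x; cases hfx : f x <;> norm_num [signOf]
    rw [sum_congr rfl fun x _ => hsign x, sum_sub_distrib, sum_const, nsmul_eq_mul, mul_one, ← mul_sum,
      ← Int.cast_sum, bb_card_cube, qs_card_liftI, show #I + 2 + 3 - 1 = #I + 4 from by omega] at hz
    set cnt : ℤ := ∑ x ∈ {x : Fin (7 + 7) → Bool | ∀ i, x i = true →
      i ∈ (insert (0 : Fin (7 + 7)) (insert (1 : Fin (7 + 7))
        (Finset.image (fun j : Fin (6 + 6) => (Fin.succ (Fin.succ j) : Fin (7 + 7))) I)))},
      (if f x = true then (1 : ℤ) else 0) with hcnt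
    have he : 2 ≤ (#I + 4) / 3 := by omega
    obtain ⟨A, hA'⟩ : ∃ A : ℤ, (2 : ℤ) ^ (#I + 2) = 4 * A := ⟨2 ^ #I, by ring⟩
    obtain ⟨Bz, hBz⟩ : ∃ Bz : ℤ, (2 : ℤ) ^ ((#I + 4) / 3) * z = 4 * Bz := by
      obtain ⟨e', he'⟩ : ∃ e', (#I + 4) / 3 = e' + 2 := ⟨_, (Nat.sub_add_cancel he).symm⟩
      exact ⟨2 ^ e' * z, by rw [he']; ring⟩
    have hzZ : (2 : ℤ) ^ (#I + 2) - 2 * cnt = (2 : ℤ) ^ ((#I + 4) / 3) * z := by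
      have h' : (2 : ℝ) ^ (#I + 2) - 2 * ((cnt : ℤ) : ℝ) = (2 : ℝ) ^ ((#I + 4) / 3) * (z : ℝ) := by
        have h'' := hz; push_cast at h'' ⊢; exact h''
      exact_mod_cast h'
    rw [hA', hBz] at hzZ
    have hcnt2 : cnt % 2 = 0 := by omega
    -- the τ-count on E_I has the parity of Σ_{E_I} Nf = cnt
    have hNsum : ∑ a ∈ {a : Fin (6 + 6) → Bool | ∀ j, a j = true → j ∈ I}, Nf a = cnt := by
      rw [hcnt, qs_sum_cube_pt]
      simp only [hNfdef]
      rw [sum_comm]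
      exact sum_congr rfl fun p _ => sum_comm
    have hfilt : ({a : Fin (6 + 6) → Bool | (∀ j, a j = true → j ∈ I) ∧ τ a = true} : Finset _) =
        ({a : Fin (6 + 6) → Bool | ∀ j, a j = true → j ∈ I} : Finset _).filter fun a => Odd (Nf a) := by
      rw [filter_filter]
      refine filter_congr fun a _ => ?_
      simp only [hτdef, decide_eq_true_eq]
    have hZ : ((#(({a : Fin (6 + 6) → Bool | ∀ j, a j = true → j ∈ I} : Finset _).filter
        fun a => Odd (Nf a)) : ℕ) : ℤ) % 2 = 0 := by
      rw [qs_card_odd_mod_two, hNsum, hcnt2]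
    rw [hfilt, Nat.even_iff]
    omega
  -- κ is cubic, of weight ≤ #supp k ≤ 511, hence zero
  have hκ3 : IsDegLeFun 3 κ := by
    have e : κ = fun a => ((decide (Odd (u₂ a)) ^^ τ a) ^^ lam a) := by
      funext a; rw [hDig a]; cases κ a <;> cases τ a <;> cases lam a <;> rfl
    rw [e]
    exact fc_deg_bxor (fc_deg_bxor hD3 (hτ.mono (by norm_num))) (hlam.mono (by norm_num))
  have hκw : (#{a : Fin (6 + 6) → Bool | κ a = true} : ℤ) ≤ 511 := by
    have hpt : ∀ a, (if κ a = true then (1 : ℤ) else 0) ≤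
        ∑ p : Bool, ∑ q : Bool,
          (if k (Fin.cons p (Fin.cons q a : Fin (6 + 6 + 1) → Bool) : Fin (7 + 7) → Bool) ≠ 0 then (1 : ℤ) else 0) := by
      intro a
      by_cases hκa : κ a = true
      · rw [if_pos hκa]
        have hK : Kq a ≠ 0 := by
          intro h0
          have : κ a = false := by simp only [hκdef, h0]; decide
          rw [this] at hκa
          exact Bool.noConfusion hκa
        simp only [hKqdef, Fintype.sum_bool] at hK ⊢
        exact qs_indicator_sum _ _ _ _ hK
      · rw [if_neg hκa]; positivity
    have hle := sum_le_sum fun a (_ : a ∈ (univ : Finset (Fin (6 + 6) → Bool))) => hpt a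
    have hL : (∑ a, (if κ a = true then (1 : ℤ) else 0)) = #{a : Fin (6 + 6) → Bool | κ a = true} := by
      rw [Finset.sum_boole]
    have hR : (∑ a : Fin (6 + 6) → Bool, ∑ p : Bool, ∑ q : Bool,
        (if k (Fin.cons p (Fin.cons q a : Fin (6 + 6 + 1) → Bool) : Fin (7 + 7) → Bool) ≠ 0 then (1 : ℤ) else 0)) =
        #{x : Fin (7 + 7) → Bool | k x ≠ 0} := by
      rw [← hcardk, qs_sum_pt, sum_comm]
      exact sum_congr rfl fun p _ => sum_comm
    rw [hL, hR] at hle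
    exact hle.trans hsupp
  have hκ0 : ∀ a, κ a = false := by
    by_contra hne
    push Not at hne
    obtain ⟨a, ha⟩ := hne
    have ha' : κ a = true := by simpa using ha
    have hRM := bb_rmWeight_holds (6 + 6) 3 κ hκ3 ⟨a, ha'⟩
    have h' : (2 : ℤ) ^ (6 + 6) ≤ 2 ^ 3 * (#{a : Fin (6 + 6) → Bool | κ a = true} : ℤ) := by exact_mod_cast hRM
    norm_num at h'
    omega
  -- so the third digit τ ⊕ λ is affine: contradiction with D3NA
  have haff : IsDegLeFun 1 (fun a => decide (Odd (u₂ a))) := by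
    have e : (fun a => decide (Odd (u₂ a))) = fun a => (τ a ^^ lam a) := by
      funext a; rw [hDig a, hκ0 a]; cases τ a <;> cases lam a <;> rfl
    rw [e]
    exact fc_deg_bxor hτ hlam
  exact digit_three_not_affine g₀ w hg₀ hW₀ u₁ u₂ t h1 h2 ht haff

end Summit.QuantumAdvantage.QuantumAdvantage.Theorems.NearExactIsExact.Negative.CaseAWindowFourteen

end
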